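import Summits.Ventures.HSemireg.WedgeHankelRecurrenceGaussJacobiDegree

/-!
# Venture HSemireg — **THE STIELTJES POLYNOMIAL AND THE ALGEBRAIC HALF OF GAUSS–KRONROD**: for positive discrete data `(ν, w)` and its monic orthogonal polynomial `Q = q_n` (degree `n < N`),
# there is a UNIQUE monic `E = E_{n+1}` of degree `n + 1` with `Σ_l ν_l Q(w_l) E(w_l) G(w_l) = 0` for all `deg G ≤ n` (STIELTJES 1894: orthogonality for the sign-changing weight `Q dν`); the
# proof is linear algebra on `ℙ_n`: `Σ ν Q H = [X^n]H · Σ ν Q²` for `deg H ≤ n`, so the `(n+1) × (n+1)` system is injective hence solvable; and KRONROD: if `Q E = ∏_{j ≤ 2n} (X − V_j)` with distinct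
# `V_j`, the interpolatory `(2n+1)`-point rule on `V` is exact in degree `≤ 3n + 1` (Jacobi N377 with `s = n`)

HONEST FRAMING. Part of the Lean index of the computation cell `pub-hsemireg` (seat p10 gen 46, Sunday typer «UNIFORM-IN-n»).  Real polynomials, finite sums and one rank count (Mathlib
`Polynomial.degreeLTEquiv`, `LinearMap.injective_iff_surjective_of_finrank_eq_finrank`); no variety, no cohomology theory, no sheaf, no Ext group and no semiregularity map is constructed here;
nothing here says that HC / HC_CM / HC_AV holds; no Literature fact (unproved `Prop`) is declared or used.  Custodian versions as in `WedgeHankelSiegelIdeal` (1/3).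
SOURCES (cited).  T. J. Stieltjes, letter to Hermite of 8 Nov. 1894, *Correspondance d'Hermite et de Stieltjes* II (1905) 439–441; G. Szegő, *Über gewisse orthogonale Polynome, die zu einer
oszillierenden Belegungsfunktion gehören*, Math. Ann. 110 (1935) 501–513, §1; A. S. Kronrod, *Nodes and Weights of Quadrature Formulas* (1964/65); G. Monegato, *Stieltjes polynomials and related
quadrature rules*, SIAM Rev. 24 (1982) 137–158, §2 (existence and uniqueness of `E_{n+1}`, eq. (2.1)–(2.3); the `3n + 1` degree of exactness); W. Gautschi, *Orthogonal Polynomials: Computation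
and Approximation* (2004), §3.1.2, Thm 3.8 (cf.).
PROOF TYPED HERE.  (i) `Σ_l ν_l Q(w_l) H(w_l) = H_n · Σ_l ν_l Q(w_l)²` for `deg H ≤ n` (`H − H_n Q` has degree `< n`).  (ii) If `deg D ≤ n` and `Σ ν Q D G = 0` for all `deg G ≤ n` then `D = 0`: else
`G = X^{n − deg D}` gives `lc(D) Σ ν Q² = 0`.  (iii) The linear map `ℙ_n → ℝ^{n+1}`, `D ↦ (Σ_l ν_l Q(w_l) D(w_l) w_l^k)_k`, is injective by (ii), so surjective by the rank count; solve for `−(X^{n+1})`'s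
vector and put `E = X^{n+1} + D`.  (iv) Uniqueness by (ii) applied to the difference.  (v) Kronrod exactness is N377 `jacobi_degree_iff` with `t = 2n`, `s = n`.
DEDUP DISCLOSURE (`rg -n -i 'kronrod|stieltjes_polynomial|stieltjesPoly' Summits/Ventures/HSemireg Literature`, 2026-09-03): nothing.  The 6 names below: 0 hits tree-wide.

WHAT IS IN THE TREE.  N273 `natDegree_sub_C_mul_le_of_monic`, `sum_mul_eval_sq_pos_of_natDegree_lt`, `natDegree_sub_lt_of_monic_of_natDegree_eq`; N377 `jacobi_degree_iff`; Mathlib `Polynomial.degreeLT`,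
`degreeLTEquiv`, `mem_degreeLT`, `eval_eq_sum_range'`, `LinearMap.injective_iff_surjective_of_finrank_eq_finrank`.
THIS FILE (namespace `Summit.Ventures.HSemireg.Wedge.HankelOuter` continued; CHAINED on N377 (import); 0 definitions):
* §1143 `orthogonal_pairing_eq_coeff_mul_norm` ((i)), `sum_mul_eval_mul_eq_sum_coeff` (monomial expansion of `Σ ν (P G)(w)`), `stieltjes_aux_eq_zero` ((ii)), **`stieltjes_polynomial_unique`**,
  **`stieltjes_polynomial_exists`**, **`kronrod_exact`** (degree `3n + 1`).
CAVEATS.  Existence ∕ uniqueness are unconditional; REAL-ROOTEDNESS of `E_{n+1}` and INTERLACING with the zeros of `Q` (needed for an actual Kronrod rule with real nodes) are NOT claimed — they fail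
in general and are hypotheses of `kronrod_exact` (`Q E = ∏ (X − V_j)`, `V` injective).  Nothing Ext-side.  New names only.
-/

open Module Polynomial
open scoped Matrix Polynomial

namespace Summit.Ventures.HSemireg.Wedge.HankelOuter

/-! ## §1143. The Stieltjes polynomial; Gauss–Kronrod (algebraic half) -/

/-- **`Σ_l ν_l Q(w_l) H(w_l) = [X^n]H · Σ_l ν_l Q(w_l)²` for `deg H ≤ n`** when `Q` is monic of degree `n` and `(ν, w)`-orthogonal to `ℙ_{n−1}`. [Szegő §3.1; this file, §1143] -/
theorem orthogonal_pairing_eq_coeff_mul_norm {N n : ℕ} {ν w : Fin N → ℝ} {Q : ℝ[X]} (hQm : Q.Monic) (hQd : Q.natDegree = n)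
    (hQo : ∀ G : ℝ[X], G.natDegree < n → ∑ l, ν l * (Q * G).eval (w l) = 0) {H : ℝ[X]} (hH : H.natDegree ≤ n) :
    ∑ l, ν l * (Q * H).eval (w l) = H.coeff n * ∑ l, ν l * (Q.eval (w l)) ^ 2 := by
  have hR := natDegree_sub_C_mul_le_of_monic hH hQm hQd
  have hsplit : H = C (H.coeff n) * Q + (H - C (H.coeff n) * Q) := by ring
  rcases Nat.eq_zero_or_pos n with h0 | hpos
  · subst h0
    have hQ1 : Q = 1 := Polynomial.eq_one_of_monic_natDegree_zero hQm hQd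
    have hHc : H = C (H.coeff 0) := eq_C_of_natDegree_le_zero hH
    rw [hQ1, Finset.mul_sum]
    refine Finset.sum_congr rfl fun l _ => ?_
    rw [one_mul, eval_one, one_pow, mul_one, hHc, eval_C, coeff_C_zero, mul_comm]
  · have hlt : (H - C (H.coeff n) * Q).natDegree < n := by omega
    have h0 := hQo _ hlt
    have hexp : ∀ l, (Q * H).eval (w l) = H.coeff n * (Q.eval (w l)) ^ 2 + (Q * (H - C (H.coeff n) * Q)).eval (w l) := fun l => by
      conv_lhs => rw [hsplit]
      simp only [eval_mul, eval_add, eval_sub, eval_C]; ring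
    simp_rw [hexp, mul_add, Finset.sum_add_distrib, h0, add_zero, Finset.mul_sum]
    exact Finset.sum_congr rfl fun l _ => by ring

/-- **Monomial expansion: `Σ_l ν_l (P G)(w_l) = Σ_{k ≤ n} [X^k]G · Σ_l ν_l P(w_l) w_l^k` for `deg G ≤ n`.** [bookkeeping; this file, §1143] -/
theorem sum_mul_eval_mul_eq_sum_coeff {N n : ℕ} (ν w : Fin N → ℝ) (P : ℝ[X]) {G : ℝ[X]} (hG : G.natDegree ≤ n) :
    ∑ l, ν l * (P * G).eval (w l) = ∑ k ∈ Finset.range (n + 1), G.coeff k * ∑ l, ν l * (P.eval (w l) * w l ^ k) := by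
  have hev : ∀ y : ℝ, G.eval y = ∑ k ∈ Finset.range (n + 1), G.coeff k * y ^ k := fun y => eval_eq_sum_range' (Nat.lt_succ_of_le hG) y
  simp_rw [eval_mul, hev, Finset.mul_sum, Finset.sum_comm (s := (Finset.univ : Finset (Fin N)))]
  exact Finset.sum_congr rfl fun k _ => Finset.sum_congr rfl fun l _ => by ring

/-- **(ii) If `deg D ≤ n` and `Σ_l ν_l Q(w_l) D(w_l) G(w_l) = 0` for every `deg G ≤ n`, then `D = 0`** (positive `ν`, at least `n + 1` distinct `w_l`). [Monegato 1982 §2; this file, §1143] -/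
theorem stieltjes_aux_eq_zero {N n : ℕ} {ν w : Fin N → ℝ} (hν : ∀ l, 0 < ν l) (hw : Function.Injective w) (hnN : n < N) {Q : ℝ[X]} (hQm : Q.Monic) (hQd : Q.natDegree = n)
    (hQo : ∀ G : ℝ[X], G.natDegree < n → ∑ l, ν l * (Q * G).eval (w l) = 0) {D : ℝ[X]} (hD : D.natDegree ≤ n)
    (hDo : ∀ G : ℝ[X], G.natDegree ≤ n → ∑ l, ν l * (Q * D * G).eval (w l) = 0) : D = 0 := by
  by_contra hD0
  have hnorm : 0 < ∑ l, ν l * (Q.eval (w l)) ^ 2 := sum_mul_eval_sq_pos_of_natDegree_lt hν hw hQm.ne_zero (by rw [hQd]; exact hnN)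
  -- `H = D · X^{n − deg D}` has degree `n` and leading coefficient `lc D ≠ 0`
  have hHd : (D * Polynomial.X ^ (n - D.natDegree)).natDegree = n := by rw [natDegree_mul hD0 (pow_ne_zero _ X_ne_zero), natDegree_X_pow]; omega
  have hHc : (D * Polynomial.X ^ (n - D.natDegree)).coeff n = D.leadingCoeff := by
    have h := leadingCoeff_mul_X_pow (p := D) (n := n - D.natDegree)
    rw [leadingCoeff, hHd] at h
    exact h
  have h1 := hDo (Polynomial.X ^ (n - D.natDegree)) (by rw [natDegree_X_pow]; omega)
  rw [mul_assoc, orthogonal_pairing_eq_coeff_mul_norm hQm hQd hQo hHd.le, hHc] at h1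
  rcases mul_eq_zero.1 h1 with h | h
  · exact hD0 (leadingCoeff_eq_zero.1 h)
  · exact hnorm.ne' h

/-- **UNIQUENESS OF THE STIELTJES POLYNOMIAL**: two monic polynomials of degree `n + 1`, both `Q dν`-orthogonal to `ℙ_n`, coincide. [Stieltjes 1894; Monegato 1982 §2; this file, §1143] -/
theorem stieltjes_polynomial_unique {N n : ℕ} {ν w : Fin N → ℝ} (hν : ∀ l, 0 < ν l) (hw : Function.Injective w) (hnN : n < N) {Q : ℝ[X]} (hQm : Q.Monic) (hQd : Q.natDegree = n)
    (hQo : ∀ G : ℝ[X], G.natDegree < n → ∑ l, ν l * (Q * G).eval (w l) = 0) {E E' : ℝ[X]} (hEm : E.Monic) (hEd : E.natDegree = n + 1) (hE'm : E'.Monic) (hE'd : E'.natDegree = n + 1)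
    (hEo : ∀ G : ℝ[X], G.natDegree ≤ n → ∑ l, ν l * (Q * E * G).eval (w l) = 0) (hE'o : ∀ G : ℝ[X], G.natDegree ≤ n → ∑ l, ν l * (Q * E' * G).eval (w l) = 0) : E = E' := by
  have hD : (E - E').natDegree ≤ n := Nat.lt_succ_iff.1 (natDegree_sub_lt_of_monic_of_natDegree_eq (by omega) hEm hEd hE'm hE'd)
  refine sub_eq_zero.1 (stieltjes_aux_eq_zero hν hw hnN hQm hQd hQo hD fun G hG => ?_)
  have h1 := hEo G hG
  have h2 := hE'o G hG
  rw [← sub_eq_zero_of_eq (h1.trans h2.symm), ← Finset.sum_sub_distrib]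
  exact Finset.sum_congr rfl fun l _ => by simp only [eval_mul, eval_sub]; ring

/-- **EXISTENCE OF THE STIELTJES POLYNOMIAL**: there is a monic `E` of degree `n + 1` with `Σ_l ν_l Q(w_l) E(w_l) G(w_l) = 0` for every `deg G ≤ n`. [Stieltjes 1894; Szegő 1935 §1; Monegato 1982
(2.1)–(2.3); this file, §1143] -/
theorem stieltjes_polynomial_exists {N n : ℕ} {ν w : Fin N → ℝ} (hν : ∀ l, 0 < ν l) (hw : Function.Injective w) (hnN : n < N) {Q : ℝ[X]} (hQm : Q.Monic) (hQd : Q.natDegree = n)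
    (hQo : ∀ G : ℝ[X], G.natDegree < n → ∑ l, ν l * (Q * G).eval (w l) = 0) :
    ∃ E : ℝ[X], E.Monic ∧ E.natDegree = n + 1 ∧ ∀ G : ℝ[X], G.natDegree ≤ n → ∑ l, ν l * (Q * E * G).eval (w l) = 0 := by
  -- the linear map `ℙ_n → ℝ^{n+1}`
  let Φ : Polynomial.degreeLT ℝ (n + 1) →ₗ[ℝ] (Fin (n + 1) → ℝ) :=
    { toFun := fun D k => ∑ l, ν l * ((Q * (D : ℝ[X])).eval (w l) * w l ^ (k : ℕ))
      map_add' := fun D D' => by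
        ext k
        show ∑ l, ν l * ((Q * ((D : ℝ[X]) + (D' : ℝ[X]))).eval (w l) * w l ^ (k : ℕ)) =
          ∑ l, ν l * ((Q * (D : ℝ[X])).eval (w l) * w l ^ (k : ℕ)) + ∑ l, ν l * ((Q * (D' : ℝ[X])).eval (w l) * w l ^ (k : ℕ))
        rw [← Finset.sum_add_distrib]
        exact Finset.sum_congr rfl fun l _ => by simp only [mul_add, eval_add, eval_mul]; ring
      map_smul' := fun c D => by
        ext k
        show ∑ l, ν l * ((Q * (c • (D : ℝ[X]))).eval (w l) * w l ^ (k : ℕ)) = c * ∑ l, ν l * ((Q * (D : ℝ[X])).eval (w l) * w l ^ (k : ℕ))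
        rw [Finset.mul_sum]
        exact Finset.sum_congr rfl fun l _ => by rw [mul_smul_comm, eval_smul, smul_eq_mul]; ring }
  have hΦ : ∀ (D : Polynomial.degreeLT ℝ (n + 1)) (k : Fin (n + 1)), Φ D k = ∑ l, ν l * ((Q * (D : ℝ[X])).eval (w l) * w l ^ (k : ℕ)) := fun _ _ => rfl
  have hdegD : ∀ D : Polynomial.degreeLT ℝ (n + 1), (D : ℝ[X]).natDegree ≤ n := fun D => by
    by_cases hD0 : (D : ℝ[X]) = 0
    · rw [hD0, natDegree_zero]; exact Nat.zero_le _
    · exact Nat.lt_succ_iff.1 ((natDegree_lt_iff_degree_lt hD0).2 (mem_degreeLT.1 D.2))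
  -- pairing against `G ∈ ℙ_n` from the vector `Φ D`
  have hpair : ∀ (P G : ℝ[X]), G.natDegree ≤ n → ∑ l, ν l * (P * G).eval (w l) = ∑ k : Fin (n + 1), G.coeff k * ∑ l, ν l * (P.eval (w l) * w l ^ (k : ℕ)) := fun P G hG => by
    rw [sum_mul_eval_mul_eq_sum_coeff ν w P hG, Finset.sum_range]
  have hinj : Function.Injective Φ := by
    rw [← LinearMap.ker_eq_bot, LinearMap.ker_eq_bot']
    intro D hD
    have hz : (D : ℝ[X]) = 0 := by
      refine stieltjes_aux_eq_zero hν hw hnN hQm hQd hQo (hdegD D) fun G hG => ?_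
      rw [hpair _ G hG]
      exact Finset.sum_eq_zero fun k _ => by rw [← hΦ, hD, Pi.zero_apply, mul_zero]
    exact Subtype.ext hz
  haveI : FiniteDimensional ℝ (Polynomial.degreeLT ℝ (n + 1)) := (Polynomial.degreeLTEquiv ℝ (n + 1)).symm.finiteDimensional
  have hfin : finrank ℝ (Polynomial.degreeLT ℝ (n + 1)) = finrank ℝ (Fin (n + 1) → ℝ) := (Polynomial.degreeLTEquiv ℝ (n + 1)).finrank_eq
  have hsurj : Function.Surjective Φ := (LinearMap.injective_iff_surjective_of_finrank_eq_finrank hfin).1 hinj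
  obtain ⟨D, hD⟩ := hsurj fun k => -∑ l, ν l * ((Q * Polynomial.X ^ (n + 1)).eval (w l) * w l ^ (k : ℕ))
  have hDlt : (D : ℝ[X]).degree < (Polynomial.X ^ (n + 1) : ℝ[X]).degree := by rw [degree_X_pow]; exact mem_degreeLT.1 D.2
  refine ⟨Polynomial.X ^ (n + 1) + (D : ℝ[X]), ?_, ?_, fun G hG => ?_⟩
  · rw [Monic, leadingCoeff_add_of_degree_lt' hDlt, leadingCoeff_X_pow]
  · rw [natDegree_add_eq_left_of_degree_lt hDlt, natDegree_X_pow]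
  · rw [hpair _ G hG]
    refine Finset.sum_eq_zero fun k _ => ?_
    have hk := congrFun hD k
    rw [hΦ] at hk
    have : ∑ l, ν l * ((Q * (Polynomial.X ^ (n + 1) + (D : ℝ[X]))).eval (w l) * w l ^ (k : ℕ)) =
        ∑ l, ν l * ((Q * Polynomial.X ^ (n + 1)).eval (w l) * w l ^ (k : ℕ)) + ∑ l, ν l * ((Q * (D : ℝ[X])).eval (w l) * w l ^ (k : ℕ)) := by
      rw [← Finset.sum_add_distrib]
      exact Finset.sum_congr rfl fun l _ => by simp only [mul_add, eval_add, eval_mul]; ring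
    rw [this, hk, add_neg_cancel, mul_zero]

/-- **GAUSS–KRONROD, the algebraic half**: if the monic Stieltjes polynomial `E` (degree `n + 1`, `Q dν`-orthogonal to `ℙ_n`) satisfies `Q · E = ∏_{j ≤ 2n} (X − V_j)` with DISTINCT real `V_j`, then
the interpolatory `(2n+1)`-point rule on the nodes `V` is exact against `(ν, w)` in every degree `≤ 3n + 1`. [Kronrod 1964; Monegato 1982 §2; Gautschi §3.1.2; this file, §1143] -/
theorem kronrod_exact {N n : ℕ} {ν w : Fin N → ℝ} {Q E : ℝ[X]} (hEo : ∀ G : ℝ[X], G.natDegree ≤ n → ∑ l, ν l * (Q * E * G).eval (w l) = 0)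
    {V μ : Fin (2 * n + 1) → ℝ} (hV : Function.Injective V) (hVQE : ∏ j, (Polynomial.X - C (V j)) = Q * E)
    (hμ : ∀ k, μ k = ∑ l, ν l * (Lagrange.basis Finset.univ V k).eval (w l)) : ∀ p, p ≤ 3 * n + 1 → ∑ j, μ j * V j ^ p = ∑ l, ν l * w l ^ p := by
  have h := (jacobi_degree_iff (t := 2 * n) (s := n) hV (μ := μ) (ν := ν) (w := w)).2 ⟨fun G hG => by rw [hVQE]; exact hEo G hG, hμ⟩
  intro p hp
  exact h p (by omega)

end Summit.Ventures.HSemireg.Wedge.HankelOuter
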